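import Summits.AnomalousDissipation.AnomalousDissipation.Theorems.TwoAndHalfDTwohalfdThesisSobolevCondensate
import Literature.Analysis.FunctionSpaces.TorusTranslationEstimate

/-!
# Lipschitz and steady Sobolev comparison flows are Sobolev condensates
(crux `TwoAndHalfD.TwohalfdThesis` = stmt-AnomalousDissipation-0206, line `Sketch`, stub SC-LIP)

Lead c7's SOBOLEV-CONDENSATE theorem `scalarNoAnomaly_of_sobolevCondensate`
(`Theorems/TwoAndHalfDTwohalfdThesisSobolevCondensate.lean`): no steady-source scalar anomaly over planar
Navier–Stokes flows `v_j` that condense, in `limsup`-mean `L²`, onto comparison flows `W_j` which are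
continuous on `ℝ × T²`, bounded by `B`, weakly divergence free, of enstrophy `‖∇W_j(t)‖²_{L²} ≤ G` and of
`L²`-speed `‖W_j(t) − W_j(s)‖_{L²} ≤ B|t − s|`.  This file makes "it CONTAINS the two sibling theorems"
kernel-checked:

* `eGradNormSq_le_of_lipschitzWith` — **Rademacher in `L²`, spectral form**: an `L`-Lipschitz planar field
  `W` (sup metric of `T² = (ℝ/ℤ)²`) has `Torus.eGradNormSq W = 4π² ∑ₖ |k|² ‖Ŵ(k)‖² ≤ 2L²`.  Proof, one axis
  at a time (`tsum_sq_freq_mul_enorm_mFourierCoeff_le_of_lipschitzWith`, any `T^d`): the translation by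
  `s eᵢ` moves points by `≤ |s|`, so `∫‖W(· + s eᵢ) − W‖² ≤ L²s²`; Parseval
  (`lintegral_enorm_sub_translate_sq_eq_tsum_complexify`, the vector form of the tree's
  `Torus.lintegral_enorm_sub_translate_sq_eq_tsum`) reads the left side as `∑ₖ |e^{2πi kᵢ s} − 1|² ‖Ŵ(k)‖²`;
  `|e^{2πi kᵢ s} − 1|²/s² → 4π² kᵢ²` (`HasDerivAt.tendsto_slope_zero` for the character) and Fatou for
  series (`ENNReal.tsum_le_liminf_tsum_of_tendsto`) give `4π² ∑ₖ kᵢ² ‖Ŵ(k)‖² ≤ L²`; sum over `i = 0, 1`.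
* `stub_scLipschitzCorollaries` — the registered tools stub, a conjunction of (i) the bound above, (ii) 0211-c7's
  REGULAR-CONDENSATE theorem (`TwohalfdNeg.RegularCondensate.scalarNoAnomaly_of_regularCondensate`, same
  statement) proved VIA the Sobolev theorem with `B = L`, `G = 2L²` — space–time `L`-Lipschitz fields are
  continuous, `L`-Lipschitz on every time slice, and `‖W(t, x) − W(s, x)‖ ≤ L|t − s|` pointwise
  (`Prod.dist_eq`), whence the `L²`-speed — and (iii) 0211-c6's STEADY SOBOLEV CONDENSATE
  (`TwohalfdNeg.Condensate.scalarNoAnomaly_of_condensate_sobolev`, same statement) proved VIA the Sobolev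
  theorem with `W_j(t) := V`, `B := sup‖V‖` (compactness), `G := ‖∇V‖²_{L²} < ∞`, `L²`-speed `0`.  The two
  corollaries are deliberately NOT separate declarations (they would restate the landed sibling theorems);
  the point is the derivation from `scalarNoAnomaly_of_sobolevCondensate`.

## References

* H. Rademacher, Math. Ann. 79 (1919) 340–359 (Lipschitz functions; here only the `L²`/Fourier shadow).
* L. Grafakos, *Classical Fourier Analysis*, 3rd ed. (2014), Prop. 3.2.7 (3) (Parseval on `𝕋ⁿ`).
* R. J. DiPerna, P.-L. Lions, Invent. Math. 98 (1989), Lemma II.1 (difference quotients of `W^{1,2}` fields).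
-/

namespace Summit.AnomalousDissipation.AnomalousDissipation.Theorems.TwohalfdThesis.SobolevCondensate

open MeasureTheory Filter Topology Set Function UnitAddTorus
open scoped ENNReal NNReal InnerProductSpace
open Literature.Analysis.FunctionSpaces Literature.Analysis.FluidPDE

set_option linter.dupNamespace false

/-! ## Parseval for translated vector fields -/

/-- Parseval for a translated real vector field through its complexification:
`∫ ‖v(x + h) − v(x)‖² dx = ∑ₖ |e_k(h) − 1|² ‖𝓕(complexify ∘ v)(k)‖²` for `v ∈ L²(T^d; ℝ^d)`
(componentwise `Torus.lintegral_enorm_sub_translate_sq_eq_tsum`, Grafakos 2014, Prop. 3.2.7 (3)). [folklore] -/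
theorem lintegral_enorm_sub_translate_sq_eq_tsum_complexify {d : Type*} [Fintype d]
    {v : UnitAddTorus d → EuclideanSpace ℝ d} (hv : MemLp v 2 volume) (h : UnitAddTorus d) :
    ∫⁻ x, ‖v (x + h) - v x‖ₑ ^ 2 =
      ∑' k : d → ℤ, ‖mFourier k h - 1‖ₑ ^ 2 * ‖mFourierCoeff (EuclideanSpace.complexify ∘ v) k‖ₑ ^ 2 := by
  classical
  -- adapted from `Torus.lintegral_enorm_sub_translate_sq_le` (TorusTranslationEstimate)
  set w : UnitAddTorus d → EuclideanSpace ℂ d := EuclideanSpace.complexify ∘ v with hw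
  have hwi : Integrable w volume :=
    EuclideanSpace.complexify.toContinuousLinearMap.integrable_comp (hv.integrable one_le_two)
  have hnorm : ∀ x, ‖v (x + h) - v x‖ₑ ^ 2 = ∑ i, ‖w (x + h) i - w x i‖ₑ ^ 2 := by
    intro x
    have : ‖v (x + h) - v x‖ₑ = ‖w (x + h) - w x‖ₑ := by
      rw [hw, Function.comp_apply, Function.comp_apply, ← map_sub, ← ofReal_norm, ← ofReal_norm,
        EuclideanSpace.norm_complexify]
    rw [this, Torus.enorm_sq_eq_sum_euclidean]
    rfl
  simp_rw [hnorm]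
  have hmeas : ∀ i, AEMeasurable (fun x => ‖w (x + h) i - w x i‖ₑ ^ 2) volume := fun i =>
    (((Torus.memLp_ofReal_apply hv i).aestronglyMeasurable.comp_measurePreserving
      (measurePreserving_add_right volume h)).sub
      (Torus.memLp_ofReal_apply hv i).aestronglyMeasurable).enorm.pow_const 2
  rw [lintegral_finsetSum' _ fun i _ => hmeas i]
  have hP : ∀ i, ∫⁻ x, ‖w (x + h) i - w x i‖ₑ ^ 2 =
      ∑' k : d → ℤ, ‖mFourier k h - 1‖ₑ ^ 2 * ‖mFourierCoeff (fun x => w x i) k‖ₑ ^ 2 :=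
    fun i => Torus.lintegral_enorm_sub_translate_sq_eq_tsum (Torus.memLp_ofReal_apply hv i) h
  simp_rw [hP]
  rw [← Summable.tsum_finsetSum fun i _ => ENNReal.summable]
  refine tsum_congr fun k => ?_
  rw [← Finset.mul_sum, Torus.enorm_sq_eq_sum_euclidean]
  congr 1
  refine Finset.sum_congr rfl fun i _ => ?_
  rw [Torus.mFourierCoeff_apply_euclidean hwi]

/-! ## Rademacher in `L²`: the spectral enstrophy of a Lipschitz field -/

/-- One axis of Rademacher's theorem in `L²(T^d)`, spectral form: for an `L`-Lipschitz field `W` on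
`T^d = (ℝ/ℤ)^d` (sup metric) and an axis `i`, `4π² ∑ₖ kᵢ² ‖Ŵ(k)‖² ≤ L²`.  Proof: the translation by
`s eᵢ` moves every point by `≤ |s|`, so `∫‖W(· + s eᵢ) − W‖² ≤ L²s²`; Parseval turns the left side into
`∑ₖ |e^{2πi kᵢ s} − 1|² ‖Ŵ(k)‖²`, and `|e^{2πi kᵢ s} − 1|²/s² → 4π²kᵢ²` as `s → 0` (derivative of the
character), so Fatou for series concludes. [folklore] -/
theorem tsum_sq_freq_mul_enorm_mFourierCoeff_le_of_lipschitzWith {d : Type*} [Fintype d] [DecidableEq d]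
    {L : ℝ≥0} {W : UnitAddTorus d → EuclideanSpace ℝ d} (hW : LipschitzWith L W) (i : d) :
    ∑' k : d → ℤ, ENNReal.ofReal (4 * Real.pi ^ 2) * ENNReal.ofReal ((k i : ℝ) ^ 2) *
        ‖mFourierCoeff (EuclideanSpace.complexify ∘ W) k‖ₑ ^ 2 ≤ (L : ℝ≥0∞) ^ 2 := by
  -- `W` is continuous, hence bounded and square integrable
  have hWc : Continuous W := hW.continuous
  obtain ⟨C, hC⟩ := Torus.exists_forall_norm_le_of_continuous hWc
  have hWm : MemLp W 2 volume := MemLp.of_bound hWc.aestronglyMeasurable C (ae_of_all _ hC)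
  have hc_top : ∀ k : d → ℤ, ‖mFourierCoeff (EuclideanSpace.complexify ∘ W) k‖ₑ ^ 2 ≠ ⊤ := fun k =>
    ENNReal.pow_ne_top enorm_ne_top
  -- the steps `sₙ = 1/(n+1)` and the axis translations `trₙ = proj (sₙ eᵢ)`
  set s : ℕ → ℝ := fun n => 1 / ((n : ℝ) + 1) with hs_def
  have hs0 : ∀ n, 0 < s n := fun n => by positivity
  have hslim : Tendsto s atTop (𝓝 0) := tendsto_one_div_add_atTop_nhds_zero_nat
  set tr : ℕ → UnitAddTorus d := fun n => Torus.proj (EuclideanSpace.single i (s n)) with htr_def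
  -- each translation moves points by at most `sₙ`
  have htr : ∀ n, ‖tr n‖ ≤ s n := by
    intro n
    refine (pi_norm_le_iff_of_nonneg (hs0 n).le).2 fun j => ?_
    rw [htr_def]
    dsimp only
    rw [Torus.proj_apply]
    refine QuotientAddGroup.norm_mk_le_norm.trans ?_
    rw [PiLp.single_apply]
    split_ifs
    · rw [Real.norm_eq_abs, abs_of_pos (hs0 n)]
    · rw [norm_zero]
      exact (hs0 n).le
  -- Step A: Parseval + Lipschitz at every step
  have hA : ∀ n, ∑' k : d → ℤ, ‖mFourier k (tr n) - 1‖ₑ ^ 2 *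
      ‖mFourierCoeff (EuclideanSpace.complexify ∘ W) k‖ₑ ^ 2 ≤ ENNReal.ofReal (((L : ℝ) * s n) ^ 2) := by
    intro n
    rw [← lintegral_enorm_sub_translate_sq_eq_tsum_complexify hWm (tr n)]
    have hpt : ∀ x, ‖W (x + tr n) - W x‖ₑ ^ 2 ≤ ENNReal.ofReal (((L : ℝ) * s n) ^ 2) := by
      intro x
      rw [← ofReal_norm, ← ENNReal.ofReal_pow (norm_nonneg _)]
      refine ENNReal.ofReal_le_ofReal (pow_le_pow_left₀ (norm_nonneg _) ?_ 2)
      rw [← dist_eq_norm]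
      refine (hW.dist_le_mul _ _).trans (mul_le_mul_of_nonneg_left ?_ L.coe_nonneg)
      rw [dist_eq_norm, add_sub_cancel_left]
      exact htr n
    calc ∫⁻ x, ‖W (x + tr n) - W x‖ₑ ^ 2
        ≤ ∫⁻ _ : UnitAddTorus d, ENNReal.ofReal (((L : ℝ) * s n) ^ 2) := lintegral_mono hpt
      _ = ENNReal.ofReal (((L : ℝ) * s n) ^ 2) := by rw [lintegral_const, measure_univ, mul_one]
  -- Step B: divide by `sₙ²`
  have hB : ∀ n, ∑' k : d → ℤ, ‖(s n)⁻¹‖ₑ ^ 2 * (‖mFourier k (tr n) - 1‖ₑ ^ 2 *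
      ‖mFourierCoeff (EuclideanSpace.complexify ∘ W) k‖ₑ ^ 2) ≤ (L : ℝ≥0∞) ^ 2 := by
    intro n
    rw [ENNReal.tsum_mul_left]
    calc ‖(s n)⁻¹‖ₑ ^ 2 * ∑' k : d → ℤ, ‖mFourier k (tr n) - 1‖ₑ ^ 2 *
          ‖mFourierCoeff (EuclideanSpace.complexify ∘ W) k‖ₑ ^ 2
        ≤ ‖(s n)⁻¹‖ₑ ^ 2 * ENNReal.ofReal (((L : ℝ) * s n) ^ 2) := mul_le_mul_right (hA n) _
      _ = (L : ℝ≥0∞) ^ 2 := by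
          rw [Real.enorm_eq_ofReal (inv_pos.2 (hs0 n)).le, ← ENNReal.ofReal_pow (inv_pos.2 (hs0 n)).le,
            ← ENNReal.ofReal_mul (sq_nonneg _), ← ENNReal.ofReal_coe_nnreal,
            ← ENNReal.ofReal_pow L.coe_nonneg]
          congr 1
          have hsn : s n ≠ 0 := (hs0 n).ne'
          field_simp
  -- Step C: the termwise limit `|e^{2πi kᵢ sₙ} − 1|²/sₙ² → 4π² kᵢ²`
  have hC : ∀ k : d → ℤ, Tendsto (fun n => ‖(s n)⁻¹‖ₑ ^ 2 * (‖mFourier k (tr n) - 1‖ₑ ^ 2 *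
      ‖mFourierCoeff (EuclideanSpace.complexify ∘ W) k‖ₑ ^ 2)) atTop
      (𝓝 (ENNReal.ofReal (4 * Real.pi ^ 2) * ENNReal.ofReal ((k i : ℝ) ^ 2) *
        ‖mFourierCoeff (EuclideanSpace.complexify ∘ W) k‖ₑ ^ 2)) := by
    intro k
    set a : ℂ := 2 * (Real.pi : ℂ) * Complex.I * ((k i : ℤ) : ℂ) with ha
    set f : ℝ → ℂ := fun t => Complex.exp (a * (t : ℂ)) with hf
    have hfval : ∀ n, mFourier k (tr n) = f (0 + s n) := by
      intro n
      rw [htr_def]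
      dsimp only
      rw [Torus.mFourier_proj_eq_exp_sum, hf, zero_add]
      dsimp only
      congr 1
      have hsum : ∑ j, (k j : ℝ) * (EuclideanSpace.single i (s n) : EuclideanSpace ℝ d) j =
          (k i : ℝ) * s n := by
        simp
      rw [hsum, ha]
      push_cast
      ring
    have hf0 : f 0 = 1 := by simp [hf]
    have hderiv : HasDerivAt f a 0 := by
      have h1 : HasDerivAt (fun t : ℝ => a * (t : ℂ)) (a * ((1 : ℝ) : ℂ)) 0 :=
        (hasDerivAt_id (0 : ℝ)).ofReal_comp.const_mul a
      have h2 := h1.cexp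
      simp only [Complex.ofReal_one, mul_one, Complex.ofReal_zero, mul_zero, Complex.exp_zero,
        one_mul] at h2
      exact h2
    have hslope : Tendsto (fun t => t⁻¹ • (f (0 + t) - f 0)) (𝓝[≠] 0) (𝓝 a) :=
      hderiv.tendsto_slope_zero
    have hsn : Tendsto s atTop (𝓝[≠] 0) :=
      tendsto_nhdsWithin_iff.2 ⟨hslim, Eventually.of_forall fun n => (hs0 n).ne'⟩
    have ha2 : ‖a‖ₑ ^ 2 = ENNReal.ofReal (4 * Real.pi ^ 2) * ENNReal.ofReal ((k i : ℝ) ^ 2) :=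
      enorm_sq_two_pi_I_mul (k i)
    have key : (fun n => ‖(s n)⁻¹‖ₑ ^ 2 * (‖mFourier k (tr n) - 1‖ₑ ^ 2 *
        ‖mFourierCoeff (EuclideanSpace.complexify ∘ W) k‖ₑ ^ 2)) =
        fun n => ‖((fun t => t⁻¹ • (f (0 + t) - f 0)) ∘ s) n‖ₑ ^ 2 *
          ‖mFourierCoeff (EuclideanSpace.complexify ∘ W) k‖ₑ ^ 2 := by
      funext n
      simp only [Function.comp_apply]
      rw [enorm_smul, mul_pow, hfval n, hf0, mul_assoc]
    rw [key, ← ha2]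
    exact ENNReal.Tendsto.mul_const
      (((ENNReal.continuous_pow 2).tendsto _).comp (hslope.comp hsn).enorm) (Or.inr (hc_top k))
  -- Step D: Fatou for series
  calc ∑' k : d → ℤ, ENNReal.ofReal (4 * Real.pi ^ 2) * ENNReal.ofReal ((k i : ℝ) ^ 2) *
        ‖mFourierCoeff (EuclideanSpace.complexify ∘ W) k‖ₑ ^ 2
      ≤ liminf (fun n => ∑' k : d → ℤ, ‖(s n)⁻¹‖ₑ ^ 2 * (‖mFourier k (tr n) - 1‖ₑ ^ 2 *
          ‖mFourierCoeff (EuclideanSpace.complexify ∘ W) k‖ₑ ^ 2)) atTop :=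
        ENNReal.tsum_le_liminf_tsum_of_tendsto hC
    _ ≤ (L : ℝ≥0∞) ^ 2 := liminf_le_of_frequently_le' (Frequently.of_forall hB)

/-- **Rademacher in `L²` on `T²`, spectral form**: an `L`-Lipschitz planar field `W` (for the sup metric
of `T² = (ℝ/ℤ)²`) has spectral enstrophy `‖∇W‖²_{L²} = 4π² ∑ₖ |k|² ‖Ŵ(k)‖² ≤ 2L²` (one `L²` per axis,
`|k|² = k₀² + k₁²`). [folklore] -/
theorem eGradNormSq_le_of_lipschitzWith {L : ℝ≥0} {W : UnitAddTorus (Fin 2) → EuclideanSpace ℝ (Fin 2)}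
    (hW : LipschitzWith L W) : Torus.eGradNormSq W ≤ 2 * (L : ℝ≥0∞) ^ 2 := by
  have h0 := tsum_sq_freq_mul_enorm_mFourierCoeff_le_of_lipschitzWith hW 0
  have h1 := tsum_sq_freq_mul_enorm_mFourierCoeff_le_of_lipschitzWith hW 1
  rw [Torus.eGradNormSq_eq_tsum, ← ENNReal.tsum_mul_left]
  have hsplit : ∀ k : Fin 2 → ℤ, ENNReal.ofReal (4 * Real.pi ^ 2) * (ENNReal.ofReal (Torus.freqNormSq k) *
      ‖mFourierCoeff (EuclideanSpace.complexify ∘ W) k‖ₑ ^ 2) =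
      ENNReal.ofReal (4 * Real.pi ^ 2) * ENNReal.ofReal ((k 0 : ℝ) ^ 2) *
          ‖mFourierCoeff (EuclideanSpace.complexify ∘ W) k‖ₑ ^ 2 +
        ENNReal.ofReal (4 * Real.pi ^ 2) * ENNReal.ofReal ((k 1 : ℝ) ^ 2) *
          ‖mFourierCoeff (EuclideanSpace.complexify ∘ W) k‖ₑ ^ 2 := by
    intro k
    rw [Torus.freqNormSq, Fin.sum_univ_two, ENNReal.ofReal_add (sq_nonneg _) (sq_nonneg _)]
    ring
  simp_rw [hsplit]
  rw [ENNReal.tsum_add, two_mul]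
  exact add_le_add h0 h1

/-! ## The registered stub -/

/-- **Registered tools stub `stub_scLipschitzCorollaries`** (SC-LIP, crux stmt-AnomalousDissipation-0206, line
`Sketch`): the Sobolev-condensate theorem CONTAINS both sibling theorems.  (i) An `L`-Lipschitz planar field has
spectral enstrophy `≤ 2L²` (`eGradNormSq_le_of_lipschitzWith`).  (ii) 0211-c7's REGULAR-CONDENSATE theorem
(`TwohalfdNeg.RegularCondensate.scalarNoAnomaly_of_regularCondensate`, same statement), proved here VIA
`scalarNoAnomaly_of_sobolevCondensate` with `B = L`, `G = 2L²`: space–time `L`-Lipschitz comparison flows bounded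
by `L` are continuous, `L`-Lipschitz on every time slice (`Prod.dist_eq`), hence of enstrophy `≤ 2L²` by (i), and
`‖W(t, x) − W(s, x)‖ ≤ L|t − s|` pointwise gives the `L²`-speed `‖W(t) − W(s)‖_{L²} ≤ L|t − s|`.  (iii) 0211-c6's
STEADY SOBOLEV CONDENSATE (`TwohalfdNeg.Condensate.scalarNoAnomaly_of_condensate_sobolev`, same statement), VIA
`scalarNoAnomaly_of_sobolevCondensate` with the constant family `W_j(t) := V`, `B := sup ‖V‖`
(`Torus.exists_forall_norm_le_of_continuous`), `G := ‖∇V‖²_{L²} < ∞` (`ENNReal.coe_toNNReal`), `L²`-speed `0`.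
[folklore] -/
theorem stub_scLipschitzCorollaries :
    (∀ (L : ℝ≥0) (W : UnitAddTorus (Fin 2) → EuclideanSpace ℝ (Fin 2)), LipschitzWith L W →
      Torus.eGradNormSq W ≤ 2 * (L : ℝ≥0∞) ^ 2) ∧
    (∀ (g : UnitAddTorus (Fin 2) → EuclideanSpace ℝ (Fin 2)) (h : UnitAddTorus (Fin 2) → ℝ) (L : ℝ≥0)
      (W : ℕ → ℝ → UnitAddTorus (Fin 2) → EuclideanSpace ℝ (Fin 2)),
      Torus.IsSmooth g → Torus.HasZeroMean g → Torus.IsSmooth h → Torus.HasZeroMean h →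
      (∀ j, LipschitzWith L (Function.uncurry (W j))) → (∀ j t x, ‖W j t x‖ ≤ L) →
      (∀ j t, Torus.IsWeaklyDivFree (W j t)) →
      ∀ (ν : ℕ → ℝ) (v₀ : ℕ → UnitAddTorus (Fin 2) → EuclideanSpace ℝ (Fin 2))
        (v : ℕ → ℝ → UnitAddTorus (Fin 2) → EuclideanSpace ℝ (Fin 2))
        (θ₀ : ℕ → UnitAddTorus (Fin 2) → ℝ) (θ : ℕ → ℝ → UnitAddTorus (Fin 2) → ℝ),
        (∀ j, 0 < ν j) → Tendsto ν atTop (𝓝 0) →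
        (∀ j, Torus.IsGlobalLerayHopf (ν j) (fun _ => g) (v₀ j) (v j)) →
        Tendsto (fun j => longTimeAvgSup (fun t => ∫ x, ‖v j t x - W j t x‖ ^ 2)) atTop (𝓝 0) →
        (∀ j, MemLp (θ₀ j) 2 volume) →
        (∀ j, Torus.IsWeakScalarTransportForced (ν j) (v j) (fun _ => h) (θ₀ j) (θ j)) →
        (∃ E : ℝ, ∀ j, longTimeAvgSup (fun t => Torus.scalarL2Sq (θ j t)) ≤ E) →
        Tendsto (fun j => longTimeAvgSup (fun t => ν j * (Torus.eScalarGradNormSq (θ j t)).toReal))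
          atTop (𝓝 0)) ∧
    (∀ (g : UnitAddTorus (Fin 2) → EuclideanSpace ℝ (Fin 2)) (h : UnitAddTorus (Fin 2) → ℝ)
      (V : UnitAddTorus (Fin 2) → EuclideanSpace ℝ (Fin 2)),
      Torus.IsSmooth g → Torus.HasZeroMean g → Torus.IsSmooth h → Torus.HasZeroMean h →
      Continuous V → Torus.IsWeaklyDivFree V → Torus.eGradNormSq V < ⊤ →
      ∀ (ν : ℕ → ℝ) (v₀ : ℕ → UnitAddTorus (Fin 2) → EuclideanSpace ℝ (Fin 2))
        (v : ℕ → ℝ → UnitAddTorus (Fin 2) → EuclideanSpace ℝ (Fin 2))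
        (θ₀ : ℕ → UnitAddTorus (Fin 2) → ℝ) (θ : ℕ → ℝ → UnitAddTorus (Fin 2) → ℝ),
        (∀ j, 0 < ν j) → Tendsto ν atTop (𝓝 0) →
        (∀ j, Torus.IsGlobalLerayHopf (ν j) (fun _ => g) (v₀ j) (v j)) →
        Tendsto (fun j => longTimeAvgSup (fun t => ∫ x, ‖v j t x - V x‖ ^ 2)) atTop (𝓝 0) →
        (∀ j, MemLp (θ₀ j) 2 volume) →
        (∀ j, Torus.IsWeakScalarTransportForced (ν j) (v j) (fun _ => h) (θ₀ j) (θ j)) →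
        (∃ E : ℝ, ∀ j, longTimeAvgSup (fun t => Torus.scalarL2Sq (θ j t)) ≤ E) →
        Tendsto (fun j => longTimeAvgSup (fun t => ν j * (Torus.eScalarGradNormSq (θ j t)).toReal))
          atTop (𝓝 0)) := by
  refine ⟨fun _ _ hW => eGradNormSq_le_of_lipschitzWith hW, ?_, ?_⟩
  · -- (ii) Lipschitz comparison flows: the Sobolev-condensate theorem with `B = L`, `G = 2L²`
    intro g h L W hgs hgz hhs hhz hWlip hWbd hWdiv ν v₀ v θ₀ θ hν hν0 hLH hfluct hθ₀ hθw hEθ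
    refine scalarNoAnomaly_of_sobolevCondensate g h (L : ℝ) (2 * L ^ 2) W hgs hgz hhs hhz
      (fun j => (hWlip j).continuous) hWbd hWdiv ?_ ?_ ν v₀ v θ₀ θ hν hν0 hLH hfluct hθ₀ hθw hEθ
    · -- enstrophy of the time slices: a space–time `L`-Lipschitz field is `L`-Lipschitz at every time
      intro j t
      have hslice : LipschitzWith L (W j t) := by
        refine LipschitzWith.of_dist_le_mul fun x y => ?_
        have hxy := (hWlip j).dist_le_mul (t, x) (t, y)
        have hd : dist (t, x) (t, y) = dist x y := by
          rw [Prod.dist_eq, dist_self, max_eq_right dist_nonneg]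
        simpa [Function.uncurry, hd] using hxy
      refine (eGradNormSq_le_of_lipschitzWith hslice).trans_eq ?_
      push_cast
      rfl
    · -- `L²`-speed: `‖W(t, x) − W(s, x)‖ ≤ L|t − s|` pointwise on the probability space `T²`
      intro j s t
      have hpt : ∀ x, ‖(W j t - W j s) x‖ ≤ (L : ℝ) * |t - s| := by
        intro x
        rw [Pi.sub_apply, ← dist_eq_norm]
        have hts := (hWlip j).dist_le_mul (t, x) (s, x)
        have hd : dist (t, x) (s, x) = |t - s| := by
          rw [Prod.dist_eq, dist_self, max_eq_left dist_nonneg, Real.dist_eq]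
        simpa [Function.uncurry, hd] using hts
      refine (eLpNorm_le_of_ae_bound (Eventually.of_forall hpt)).trans ?_
      rw [measure_univ, ENNReal.one_rpow, one_mul]
  · -- (iii) steady Sobolev condensate: the constant family `W_j(t) = V`, `B = sup ‖V‖`, `G = ‖∇V‖²`, speed `0`
    intro g h V hgs hgz hhs hhz hVc hVdiv hVH ν v₀ v θ₀ θ hν hν0 hLH hfluct hθ₀ hθw hEθ
    obtain ⟨C, hC⟩ := Torus.exists_forall_norm_le_of_continuous hVc
    exact scalarNoAnomaly_of_sobolevCondensate g h C (Torus.eGradNormSq V).toNNReal (fun _ _ => V)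
      hgs hgz hhs hhz (fun _ => hVc.comp continuous_snd) (fun _ _ x => hC x) (fun _ _ => hVdiv)
      (fun _ _ => (ENNReal.coe_toNNReal hVH.ne).ge) (fun _ s t => by simp) ν v₀ v θ₀ θ hν hν0 hLH
      hfluct hθ₀ hθw hEθ

end Summit.AnomalousDissipation.AnomalousDissipation.Theorems.TwohalfdThesis.SobolevCondensate
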